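import Mathlib
import HarnessLib
import HarnessLib.Audit
import Summits.BirchSwinnertonDyer.Statement
import Literature.NumberTheory.EllipticCurves.GrossLMS1991.HeegnerEulerSystemCongruenceImageFree
import Literature.NumberTheory.EllipticCurves.HeegnerPointsKolyvaginStructure
import Literature.NumberTheory.EllipticCurves.SelmerCorankHolds
import HarnessLib.Audit.Status.Attr

/-!
Route: KolyvaginDepthDoor

# Route KolyvaginDepthDoor — X1 at rank ≥ 2 as non-vanishing of the first admissible Kolyvagin class
(depth = rank − 1), KN SIGNED-DATUM form (rev 1)

D-0145 LINE (ideator bsd-idea-4, technique card «splitting / non-equivalent criterion search»; rank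
≥ 2 DOOR — no summit and no class theorem at rank ≥ 2 is proved by this line; BSD is NOT proved by
it). It suffices to show X = KDS_KN ∧ (γ) ∧ X1_CM ∧ X2 ∧ X3 where the conjunct KDS_KN («Kolyvagin
depth supply, Kodaira–Néron signed datum», item KolyvaginDepthSupplyKN — the re-typing of the
original KolyvaginDepthSupply asked by director-bsd (210)(d) after the prover lineage kdd-p1 g0–g9;
verbatim the tree definition `Theorems.KolyvaginDepthDoor.KolyvaginDepthSupplySignedDatumKN`)
REPLACES the non-CM part of KatoTransfer's X1 `ShaCorankZeroAtOnePrime` (stmt-18411, corank_ℤ_p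
Ш(E)[p^∞] = 0 at ONE good ordinary p ≥ 5): for every non-CM E/ℚ there are an admissible prime p ≥ 5
(good ordinary, ρ_{E,p^∞} onto, p ∤ ord_v(Δ_min) at the multiplicative places = the Kodaira–Néron
cell), a Heegner field K (d_K ≠ −3, −4), a square-free product n₁ of Kolyvagin primes and a
Kolyvagin–Heegner datum whose FIRST class c_1(n₁) ≠ 0, with the two-sign rank clause ν(n₁)+1 ≤ rank
E(ℚ) ∨ (ν(n₁) ≤ rank E(ℚ) ∧ ν(n₁)+1 ≤ rank E^(d_K)(ℚ)). The KN DOOR (item KolyvaginDoorKN, provable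
now: it is the landed theorem `shaCorank_eq_zero_nonCM_of_kolyvaginDepthSupplySignedDatumKN_print`,
p647397 lineage, which derives Kolyvagin's structure theorem on the Kodaira–Néron cell from the ONE
named published input (γ) = `GrossLMS1991.prop37_2_frobeniusCongruence`, item
GrossFrobeniusCongruence) turns KDS_KN + (γ) into X1 on non-CM curves; X1 on CM curves is the
separate crux X1_CM; X2, X3 and the Kato side are KatoTransfer's items verbatim (shared). The
original door KolyvaginDepthSupply (level-M classes, mod-p surjectivity, minimal-depth clause; NOT
refuted — its level-1 «Datum/System» re-typings were, p642351, witness 480a1^(−1)) and the by-name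
fact KolyvaginStructure are retired to `aside` (banked: calibration p582259, depth-table helpers).
Lean: `KolyvaginDepthSupplyKN ∧ GrossFrobeniusCongruence ∧ ShaCorankZeroAtOnePrimeOfCM ∧
AnalyticRankLeSelmerCorank ∧ PadicOrderLeAnalyticRankAtOnePrime`

## Assembly
The deciding theorem `closes` (glue.lean, sorry-free, lean-checked rc 0) obtains X1 at one prime for
EVERY elliptic curve — non-CM: `KolyvaginDoorKN hS hγ`, CM: `ShaCorankZeroAtOnePrimeOfCM` — and then
runs KatoTransfer's certified assembly verbatim (global minimal model transport (T1)–(T3); leg 1: X1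
+ the proved Kummer identity `selmerCorank_eq_mordellWeilRank_add_holds` + X2 ⇒ r_an ≤ r_MW; leg 2:
X3 + Kato ⇒ r_MW ≤ r_an). Hypotheses of `closes`: KolyvaginDepthSupplyKN, GrossFrobeniusCongruence,
KolyvaginDoorKN, ShaCorankZeroAtOnePrimeOfCM, AnalyticRankLeSelmerCorank,
PadicOrderLeAnalyticRankAtOnePrime, KatoRankBound — every one OPEN or print; nothing class-wide is
discharged.

Rationale: WHY THIS LINE. At r = rank E(ℚ) ≥ 2 the statement X1 (t_p := corank Ш(E)[p^∞] = 0) has no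
computational handle of its own (the divisible part of Ш is invisible to descent:
Literature.Barriers.BirchSwinnertonDyer.SelmerRankBarrierNarrow); Kolyvagin1991MathAnn Thm. 4
(restated WZhang2014 Thm. 11.2(i), BurungaleEtAl2026 Cor. 1) reads the Selmer corank off the DEPTH
of the first non-zero derived Heegner class. Read «points first» (two known independent points, r ≥
2) a COMPUTED non-zero class at depth r − 1 certifies corank = r, i.e. t_p = 0 — with NO p-adic
L-function, NO main conjecture and NO p-adic height (Schneider) input; the instrument is the
Jetchev–Lauter–Stein algorithm (arXiv:0707.0032 §3.6) or, mod p, the Bertolini–Darmon / W. Zhang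
explicit reciprocity. REV 1 (2026-08-28, director-bsd (210)(d)): the prover lineage kdd-p1 g0–g9 (≈
60 accepted helper files) DERIVED the structure theorem in tree on the Kodaira–Néron cell from the
one named input (γ) = Gross 1991 Prop. 3.7 (2) and showed the level-1 «Datum/System» re-typings
FALSE (p642351: they force positive rank on every non-CM E; witness 480a1^(−1), rank 0 by the tree's
2-descent) while the two-sign SIGNED datum survives; the door is therefore re-typed as the KN signed
datum (SIGNED-DATUM.md v2, evidence #17 on stmt-21765), whose chain to BSD-rank uses (γ) alone
(p647397) — no F1 (Gross's E⁰ lemma), no KolyvaginStructure, no McCallum leaf. NOVEL VS LISTED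
ROUTES: KatoTransfer / PAdicOrderV2 / LambdaDoorKernel / CountingDoorF2AtThree certify X1 per curve
through the CYCLOTOMIC criterion ord_T L_p = r (λ-door, Stein–Wuthrich 2013); no listed route types
the ANTICYCLOTOMIC depth criterion as the X1-door; the two criteria are not known to imply each
other class-wide and their per-curve AGREEMENT is a falsifiable instrument row. bears_on: LADDER-BSD
S0 doors / N3–N4 (rank-2 X1 door), D-0131 class 12; observatory pub-bsdr2.

RANKED CRUXES. #2 KolyvaginDepthSupplyKN (crux, open-problem) — the KN signed datum above (verbatim
`Theorems.KolyvaginDepthDoor.KolyvaginDepthSupplySignedDatumKN`); why it might fail: class-wide it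
is X1|nonCM-strength (t_p = 0 at one admissible KN prime for every non-CM E), open at rank ≥ 2
[Kolyvagin1991MathAnn, WZhang2014, GrossLMS1991, BurungaleEtAl2026, arXiv:0707.0032]. #3
AnalyticRankLeSelmerCorank (KatoTransfer X2 verbatim, stmt-18412). #4
PadicOrderLeAnalyticRankAtOnePrime (KatoTransfer X3 verbatim, stmt-18413). #5
ShaCorankZeroAtOnePrimeOfCM (X1 on CM curves, the residual class the depth door cannot reach: no odd
prime of surjective image). #9 GrossFrobeniusCongruence (support, print: (γ) by name). #9
KolyvaginDoorKN (support, provable now from the landed KN door p647397: KDS_KN → (γ) → X1|nonCM). #9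
KatoRankBound (KatoTransfer's Kato side verbatim, stmt-0491). Aside (banked, never staffed):
KolyvaginDepthSupply (original door, superseded, not refuted), KolyvaginStructure (by-name Kolyvagin
Thm 4, no longer in the chain).

KILL CRITERIA. A non-CM curve with NO prime p ≥ 5 that is simultaneously good, ordinary,
tower-surjective, prime to ord_v(Δ_min) at every multiplicative v and admissible for some Heegner K
with d_K ≠ −3, −4 refutes KolyvaginDepthSupplyKN as MISSTATED (repair: weaken tower-surjectivity to
Kolyvagin's p ∈ B(E) or drop the KN conjunct and re-admit F1); a proof that t_p > 0 for some non-CM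
(E, every admissible p) refutes it substantively and kills X1 of KatoTransfer with it (close
refuted: KolyvaginDepthSupplyKN). X2 or X3 refuted ⇒ both this route and KatoTransfer die.
KatoTransfer's X1 proved outright ⇒ this route is superseded (its door remains an instrument).

NOT DECOMPOSED YET. The rank-2 slice («ν = 1 on rank-2 curves», the door proper, instrumentable
curve by curve) vs rank ≥ 3 / rank ≤ 1; the reciprocity-law reformulation (BD 2005 / W. Zhang 2014
§4: loc_ℓ′ c(ℓ) ≠ 0 ⇔ a Gross period of the level-raised definite form is a p-unit); the
Heegner-field / twist-rank supply (BFH, Murty–Murty, Waldspurger + GZK — folded into the ∃ K); CM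
curves beyond naming the residual.

CHEAPEST FALSIFIER. INSTRUMENT ROW «DEPTH TABLE» (landed by kdd-p1 as ≈ 44 bit-free vanishing rows
on (γ) only + kit rows): for the 18 Cremona rank-2 curves N ≤ 1000 and admissible p ∈ {5, 7},
Heegner K with r_an(E^(d_K)) = 1, the three smallest Kolyvagin primes ℓ: is c_1(ℓ) ≠ 0 (JLS
algorithm)? Calibration: Stein–Wuthrich 2013 Thm 1.1 certifies Ш(E)[p] = 0 for these (E, p) by the
λ-door and W. Zhang 2014 Thm 1.1 predicts a non-zero class at depth exactly 1; a table where every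
c_1(ℓ) vanishes for a curve with certified Ш[p] = 0 signals a MISSTATEMENT of the crux's conventions
— the cheapest kill. Known data point: JLS Prop. 3.10 (389a1, p = 3, ℓ = 5, D = 7): κ_5,1 ≠ 0 at
depth 1 = rank − 1 (p = 3 calibrates, below the crux's p ≥ 5).

Novelty: Searches (2026-08-27): tree `rg Kolyvagin1991|KolyvaginStructure` (1 fact file + SelmerRank LB line,
analytic direction only); `lit search
"Kolyvagin conjecture explicit Heegner points Jetchev Lauter Stein"` (6 local: arXiv:0707.0032,
arXiv:math/0703431, arXiv:1909.03959,
arXiv:2112.02016 …; remote: doi:10.1016/j.jnt.2008.05.007, doi:10.1007/s10114-021-8355-7 Wan 2021);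
`lit read arxiv:0707.0032 --grep`
(Cor. 3.5 = analytic direction; Prop. 3.10 = depth-1 computations for three rank-2 curves, the
algebraic consequence t_p = 0 not drawn);
`ledger negatives --problem BirchSwinnertonDyer` (1: TamePinch, CM witness — honoured by the ¬HasCM
split).
Nearest prior art found: Kolyvagin1991MathAnn Thm 4 / WZhang2014 Thm 11.2 (the structure theorem),
arXiv:0707.0032 §3.6 (the
instrument), SteinWuthrich2013 (the cyclotomic competitor), tree route SelmerRank line heegner_order
(same fact, opposite direction).
Delta: types the anticyclotomic DEPTH criterion as the rank ≥ 2 X1-door — a per-curve certificate of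
corank Ш[p^∞] = 0 needing no
p-adic L-function, main conjecture, ordinarity or p-adic height — and names its class-wide residual,
pairing it with the λ-door as a
non-equivalent criterion whose per-curve agreement is checkable.
Claimed grade: new-combination  [refs: 10.1016/j.jnt.2008.05.007, 10.1007/s10114-021-8355-7, 0707.0032, math/0703431, 1909.03959, 2112.02016, doi:10.1016/j.jnt.2008.05.007, doi:10.1007/s10114-021-8355-7, arxiv:0707.0032, Kolyvagin1991, WZhang2014, SteinWuthrich2013]

Barriers (technique_class: kolyvagin-systems, heegner-points, selmer-structure): - technique_class: kolyvagin-systems, heegner-points, selmer-structure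
- Literature.Barriers.BirchSwinnertonDyer.SelmerRankBarrierNarrow: inside its letter («points first,
Ш after»: the door needs the r known points) — it obstructs UNIFORM theorems only; the class-wide
crux is conceded to be X1-hard and is typed as non-vanishing of explicit classes, the form
level-raising induction (W. Zhang 2014) and Kolyvagin-system rigidity (Howard, BCGS 2026) act on.
- Literature.Barriers.BirchSwinnertonDyer.SelmerRankBarrier: same placement — the route never infers
rank from a Selmer bound; it infers corank Ш = 0 from rank (known points) plus the depth of a
non-zero class.
- Literature.Barriers.BirchSwinnertonDyer.HeegnerPointBarrierNarrow: evaded by name — the entry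
covers the bottom class c(1) = δy_K (and χ = 1 projections of CM points) as a POINT supply; the door
uses DERIVED classes c_M(n), n > 1, at the Selmer level, which the entry's own correction excludes
from its scope (their rank ≥ 2 obstruction is SelmerRankBarrier, placed above).
- Literature.Barriers.BirchSwinnertonDyer.HeegnerPointBarrier: as the Narrow entry — no K-rational
Heegner point is used as a point of E(ℚ); y_K is torsion at rank ≥ 2 and the door starts at depth 1.
- Literature.Barriers.BirchSwinnertonDyer.NumericalVanishingBarrier: outside — no value L^(k)(E,1)
is used; the door certifies the algebraic side t_p = 0 from an algebraic non-divisibility.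
- Literature.Barriers.BirchSwinnertonDyer.PAdicHeightBarrier: ou

sub-problem: BirchSwinnertonDyer · status: open · opened planner-bsd-idea-4-g0-0 2026-08-27T20:22:20Z · rev 4 · ledger route-BirchSwinnertonDyer-KolyvaginDepthDoor
GENERATED by the gate from the ledger (D-0016/17). Provers cite these decls: `theorem foo : Summit.BirchSwinnertonDyer.BirchSwinnertonDyer.Theses.KolyvaginDepthDoor.<Decl> := …` in Summits/BirchSwinnertonDyer/BirchSwinnertonDyer/Theorems/<Name>.lean.
-/

namespace Summit.BirchSwinnertonDyer.BirchSwinnertonDyer.Theses.KolyvaginDepthDoor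

open scoped BigOperators Topology Manifold Classical MeasureTheory ProbabilityTheory Matrix InnerProductSpace ComplexConjugate ContinuousMap
open Filter Set Function TopologicalSpace MeasureTheory

attribute [summit_statement] _root_.BirchSwinnertonDyer

open Literature

/-- item stmt-BirchSwinnertonDyer-22820 · crux · rank 2 · open · by planner
why it might fail: class-wide it is X1|nonCM-strength (t_p = 0 at one admissible KN prime for EVERY non-CM E): open at rank ≥ 2; a non-CM E with Ш[p^∞] infinite at every tower-surjective KN prime p ≥ 5 refutes it (none known; BSD forbids).
sources: Kolyvagin1991MathAnn, WZhang2014, GrossLMS1991, BurungaleEtAl2026, arXiv:0707.0032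
[crux] KN SIGNED DATUM (re-typing of KolyvaginDepthSupply per SIGNED-DATUM.md v2; verbatim the tree
def `Theorems.KolyvaginDepthDoor.KolyvaginDepthSupplySignedDatumKN`): for every non-CM elliptic E/ℚ
(global minimal model) there are a prime p ≥ 5, good ordinary, with ρ_{E,p^n} surjective for all n
and p ∤ ord_v(Δ_min) at every multiplicative place v (Kodaira–Néron cell), an imaginary quadratic
Heegner field K (d_K ≠ −3, −4), a modular parametrisation datum, a square-free product n₁ of
Kolyvagin primes (W. Zhang's sense) and a Kolyvagin–Heegner datum d of conductor n₁ whose FIRST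
class c_1(n₁) ≠ 0, with the two-sign rank clause ν(n₁)+1 ≤ rank E(ℚ) ∨ (ν(n₁) ≤ rank E(ℚ) ∧ ν(n₁)+1
≤ rank E^(d_K)(ℚ)). Strength: «Ш(E/ℚ)[p] = 0 at an admissible Kodaira–Néron prime» on non-CM curves
(calibration p582259 / KN door p647397). [deps: GrossFrobeniusCongruence, KolyvaginDoorKN]
[difficulty: open-problem] -/
@[route_item "route-BirchSwinnertonDyer-KolyvaginDepthDoor", crux]
def KolyvaginDepthSupplyKN : Prop :=
  ∀ (W : WeierstrassCurve ℚ) [W.IsElliptic] [W.IsGloballyMinimal], ¬ W.HasCM → ∃ (p : ℕ) (hp : Fact p.Prime), 5 ≤ p ∧ W.HasGoodReductionAtPrime p ∧ ¬ (p : ℤ) ∣ W.frobeniusTrace p ∧ (∀ n : ℕ, W.HasSurjectiveModNGaloisRep (p ^ n : ℕ)) ∧ (∀ v : IsDedekindDomain.HeightOneSpectrum (NumberField.RingOfIntegers ℚ), W.HasMultiplicativeReductionAt v → ¬ p ∣ W.ordMinimalDiscriminant v) ∧ ∃ (K : Type) (_ : Field K) (_ : NumberField K), Literature.NumberTheory.EllipticCurves.IsImaginaryQuadratic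 K ∧ NumberField.discr K ≠ -3 ∧ NumberField.discr K ≠ -4 ∧ ∃ (_ : NeZero (W.conductorNorm ℤ)), Literature.NumberTheory.EllipticCurves.SatisfiesHeegnerHypothesis (W.conductorNorm ℤ) K ∧ ∃ (Dt : Literature.NumberTheory.EllipticCurves.ModularForms.ModularParametrizationData W (W.conductorNorm ℤ)) (β : ℤ) (ι : K →+* ℂ) (n₁ : ℕ) (d : Literature.NumberTheory.EllipticCurves.KolyvaginHeegnerData Dt β ι n₁), Squarefree n₁ ∧ (∀ q ∈ n₁.primeFactors, Literature.NumberTheory.EllipticCurves.Zhang2014.IsKolyvaginPrime (W.conductorNorm ℤ) W K p q) ∧ d.kolyvaginClass hp.out 1 ≠ 0 ∧ (n₁.primeFactors.card + 1 ≤ W.mordellWeilRank ∨ (n₁.primeFactors.card ≤ W.mordellWeilRank ∧ n₁.primeFactors.card + 1 ≤ (W.quadraticTwist (NumberField.discr K : ℚ)).mordellWeilRank))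

/-- item stmt-BirchSwinnertonDyer-18412 · crux · rank 3 · open · by planner
why it might fail: known only for corank ≤ 1 (p-converse theorems); corank ≥ 2 needs non-vanishing of L^(s_p)(E,1) from Selmer smallness, for which no tool exists (barrier NumericalVanishing).
sources: Skinner2020, WZhang2014, BurungaleTian2019, CastellaGrossiSkinner2025
[crux] for every elliptic E/ℚ (global minimal model) and every prime p ≥ 5 of good ordinary
reduction, ord_{s=1} L(E,s) ≤ corank_{ℤ_p} Sel_{p^∞}(E/ℚ) (card item X2; the ≤ half of the rank-r
p-converse, a consequence of BSD). [difficulty: open-problem] -/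
@[route_item "route-BirchSwinnertonDyer-KolyvaginDepthDoor", crux]
def AnalyticRankLeSelmerCorank : Prop :=
  ∀ (W : WeierstrassCurve ℚ) [W.IsElliptic] [W.IsGloballyMinimal] (p : ℕ) [Fact p.Prime], 5 ≤ p → W.HasGoodReductionAtPrime p → ¬ (p : ℤ) ∣ W.frobeniusTrace p → W.analyticRank ≤ W.selmerCorank p

/-- item stmt-BirchSwinnertonDyer-18413 · crux · rank 4 · open · by planner
why it might fail: r_an ≥ 2 needs [T^r_an] L_p ≠ 0 at one p with no formula linking L^(k)(E,1), k ≥ 2, to L_p; r_an = 1 is Schneider's conjecture at one prime.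
sources: Schneider1985, MazurTateTeitelbaum1986, SteinWuthrich2013, Kato2004Asterisque
[crux] for every elliptic E/ℚ (global minimal model) there are a prime p ≥ 5 of good ordinary
reduction and a weight-2 newform f of E with ord_T L_p(f, α_p, T) ≤ ord_{s=1} L(E,s) (card item X3,
ordinary disjunct, ∃f form). [difficulty: open-problem] -/
@[route_item "route-BirchSwinnertonDyer-KolyvaginDepthDoor", crux]
def PadicOrderLeAnalyticRankAtOnePrime : Prop :=
  ∀ (W : WeierstrassCurve ℚ) [W.IsElliptic] [W.IsGloballyMinimal], ∃ (p : ℕ) (_ : Fact p.Prime), 5 ≤ p ∧ W.HasGoodReductionAtPrime p ∧ ¬ (p : ℤ) ∣ W.frobeniusTrace p ∧ ∃ (N : ℕ) (_ : NeZero N) (f : CuspForm (CongruenceSubgroup.Gamma0 N) 2), Literature.NumberTheory.EllipticCurves.ModularForms.IsNewformOf W f ∧ (Literature.NumberTheory.EllipticCurves.padicLFunction f (Literature.NumberTheory.EllipticCurves.unitRoot W p : ℚ_[p])).order ≤ (W.analyticRank : ℕ∞)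

/-- item stmt-BirchSwinnertonDyer-21766 · crux · rank 5 · open · by planner
why it might fail: CM curves of rank ≥ 2 exist (y² = x³ − 34²x, rank 2) and Rubin's CM main conjecture gives no corank bound by points there; a CM curve with t_p > 0 at every ordinary p would refute it (none known; BSD forbids it).
sources: Rubin1991, SteinWuthrich2013, Kato2004Asterisque
[crux] X1 restricted to CM curves: every CM elliptic E/ℚ (global minimal model) has a good ordinary
prime p ≥ 5 with corank_ℤ_p Ш(E)[p^∞] = 0 (the residual class the depth door cannot reach: no odd
prime of surjective image, Serre 1972 §4.5 — the TamePinch lesson of the negatives index).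
[difficulty: open-problem] -/
@[route_item "route-BirchSwinnertonDyer-KolyvaginDepthDoor", crux]
def ShaCorankZeroAtOnePrimeOfCM : Prop :=
  ∀ (W : WeierstrassCurve ℚ) [W.IsElliptic] [W.IsGloballyMinimal], W.HasCM → ∃ (p : ℕ) (_ : Fact p.Prime), 5 ≤ p ∧ W.HasGoodReductionAtPrime p ∧ ¬ (p : ℤ) ∣ W.frobeniusTrace p ∧ W.shaCorank p = 0

/-- item stmt-BirchSwinnertonDyer-21765 · aside · rank 2 · open · by planner
why it might fail: modulo BCGS 2026 Thm 1 + Kolyvagin + GZK it is EQUIVALENT to t_p = 0 at one admissible p for every non-CM E — open at rank ≥ 2; superseded (not refuted) by KolyvaginDepthSupplyKN; its Datum/System re-typings were refuted p642351 (480a1 twist)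
sources: Kolyvagin1991MathAnn, WZhang2014, BurungaleEtAl2026, arXiv:0707.0032, GrossLMS1991
[crux] for every non-CM elliptic E/ℚ (global minimal model) there are p ≥ 5 good ordinary with
ρ̄_E,p surjective, an imaginary quadratic K (d_K ≠ −3, −4, p ∤ d_K·N, Heegner hypothesis for N), a
modular parametrisation datum, a square-free product n of Kolyvagin primes, a Kolyvagin–Heegner
datum of conductor n and a level 1 ≤ M ≤ M(n) with c_M(n) ≠ 0, of minimal depth among all non-zero
classes of the system, and (ν(n)+1 = rank E(ℚ) > rank E^(d_K)(ℚ)) ∨ (ν(n) = rank E(ℚ) = rank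
E^(d_K)(ℚ) − 1). [difficulty: open-problem] -/
@[route_item "route-BirchSwinnertonDyer-KolyvaginDepthDoor"]
def KolyvaginDepthSupply : Prop :=
  ∀ (W : WeierstrassCurve ℚ) [W.IsElliptic] [W.IsGloballyMinimal], ¬ W.HasCM → ∃ (p : ℕ) (hp : Fact p.Prime), 5 ≤ p ∧ W.HasGoodReductionAtPrime p ∧ ¬ (p : ℤ) ∣ W.frobeniusTrace p ∧ W.HasSurjectiveModNGaloisRep p ∧ ∃ (K : Type) (_ : Field K) (_ : NumberField K), Literature.NumberTheory.EllipticCurves.IsImaginaryQuadratic K ∧ NumberField.discr K ≠ -3 ∧ NumberField.discr K ≠ -4 ∧ ¬ ((p : ℤ) ∣ NumberField.discr K) ∧ ¬ (p ∣ W.conductorNorm ℤ) ∧ ∃ (_ : NeZero (W.conductorNorm ℤ)), Literature.NumberTheory.EllipticCurves.SatisfiesHeegnerHypothesis (W.conductorNorm ℤ) K ∧ ∃ (Dt : Literature.NumberTheory.EllipticCurves.ModularForms.ModularParametrizationData W (W.conductorNorm ℤ)) (β : ℤ) (ι : K →+* ℂ) (n : ℕ) (d : Literature.NumberTheory.EllipticCurves.KolyvaginHeegnerData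 Dt β ι n) (M : ℕ), Literature.NumberTheory.EllipticCurves.KolyvaginDescent.KolSupp (Literature.NumberTheory.EllipticCurves.Zhang2014.IsKolyvaginPrime (W.conductorNorm ℤ) W K p) n ∧ 1 ≤ M ∧ (M : ℕ∞) ≤ Literature.NumberTheory.EllipticCurves.Zhang2014.levelIndex W p n ∧ d.kolyvaginClass hp.out M ≠ 0 ∧ (∀ (n' : ℕ) (d' : Literature.NumberTheory.EllipticCurves.KolyvaginHeegnerData Dt β ι n') (M' : ℕ), Literature.NumberTheory.EllipticCurves.KolyvaginDescent.KolSupp (Literature.NumberTheory.EllipticCurves.Zhang2014.IsKolyvaginPrime (W.conductorNorm ℤ) W K p) n' → 1 ≤ M' → (M' : ℕ∞) ≤ Literature.NumberTheory.EllipticCurves.Zhang2014.levelIndex W p n' → d'.kolyvaginClass hp.out M' ≠ 0 → n.primeFactors.card ≤ n'.primeFactors.card) ∧ ((n.primeFactors.card + 1 = W.mordellWeilRank ∧ (W.quadraticTwist (NumberField.discr K : ℚ)).mordellWeilRank < W.mordellWeilRank) ∨ (n.primeFactors.card = W.mordellWeilRank ∧ (W.quadraticTwist (NumberField.discr K : ℚ)).mordellWeilRank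 = W.mordellWeilRank + 1))

/-- item stmt-BirchSwinnertonDyer-0491 · support · rank 9 · open · by planner
sources: Kato2004Asterisque, SteinWuthrich2013, Rubin2000
SUPERSEDES stmt-BirchSwinnertonDyer-0139 (r2). The old item was FALSELY closed 2026-08-13T06:58:11Z
by the gate decides-probe of p2749 as 'proved' by
Literature.EllArith.HigherGrossZagierDatum.leadingLCoeff_eq / det_ne_zero_of_leadingLCoeff_ne_zero —
lemmas taking (D : HigherGrossZagierDatum W W.analyticRank) as hypothesis, which cannot inhabit this
Prop (the same probe 'proved' both old 0145 and its negation-side 0257). Statement, rank and route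
unchanged; grounder/refuter notes on stmt-BirchSwinnertonDyer-0139 remain valid and should be
copied, not redone. Near-Literature inequality validating all normalisations: rank ≤ corank
Sel_{p^∞} (Kummer) ≤ ord_T char_Λ X(E/ℚ_∞) (Mazur control, Greenberg1999 §4) ≤ ord_T L_p (Kato2004
Thm 17.4 divisibility in Λ⊗ℚ_p = Literature.NumberTheory.EllipticCurves.kato_divisibility). Rubin,
Euler Systems, needs p ≠ 2. imports: Summits.BirchSwinnertonDyer.Statement,
Literature.NumberTheory.EllipticCurves.PAdicBSD (routes/SketchPAdic.lean). NOT elaborated at filing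
time: DiophantineGeometry/Conductor.olean missing from the shared build (import fails before the
term is read); every constant checked against source. Refuter: re-check after rebuild. -/
@[route_item "route-BirchSwinnertonDyer-KolyvaginDepthDoor", crux]
def KatoRankBound : Prop :=
  ∀ (W : WeierstrassCurve ℚ) [W.IsElliptic] [W.IsGloballyMinimal] (p : ℕ) [Fact p.Prime], p ≠ 2 → Literature.NumberTheory.EllipticCurves.IsOrdinaryAt W p → ∀ {N : ℕ} [NeZero N] (f : CuspForm (CongruenceSubgroup.Gamma0 N) 2), Literature.NumberTheory.EllipticCurves.ModularForms.IsNewformOf W f → (W.mordellWeilRank : ℕ∞) ≤ (Literature.NumberTheory.EllipticCurves.padicLFunction f (Literature.NumberTheory.EllipticCurves.unitRoot W p : ℚ_[p])).order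

/-- item stmt-BirchSwinnertonDyer-21767 · aside · rank 9 · open · by planner
why it might fail: by-name Literature fact (Kolyvagin 1991 Thm 4 / W. Zhang 2014 Thm 11.2(i)); not a claim of this route any more — the KN door chain derives X1|nonCM from (γ) on the Kodaira–Néron cell
sources: Kolyvagin1991MathAnn, WZhang2014, BurungaleEtAl2026
[support] Kolyvagin 1991 Thm. 4 / W. Zhang 2014 Thm. 11.2(i) BY NAME — the Literature fact
`Kolyvagin1991_selmerCorank_of_kolyvaginClass_ne_zero` (XL, no `_holds`; cited, not restated): a
non-zero class of minimal depth ν gives corank = ν+1 on one eigenspace and ≤ ν, of the parity of ν,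
on the other. [difficulty: XL] -/
@[route_item "route-BirchSwinnertonDyer-KolyvaginDepthDoor"]
def KolyvaginStructure : Prop :=
  Literature.NumberTheory.EllipticCurves.Kolyvagin1991_selmerCorank_of_kolyvaginClass_ne_zero

/-- item stmt-BirchSwinnertonDyer-23091 · support · rank 9 · open · by planner
[aside, cite-only] Gross 1991 Prop. 3.7 (2) (Nekovář 2007 Prop. 4.9/4.13(ii)): the Frobenius
congruence y_n ≡ Frob_ℓ y_m (mod λ_n) of the Heegner Euler system, image-free named fact (PUBLISHED;
no mod-p image or CM hypothesis). Print head (γ) of p4's stub_jetchevX9 chain. [cite: GrossLMS1991,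
Prop. 3.7 (2) p. 240] [cite: Nekovar2007, Prop. 4.9, 4.13 (ii)] — conjunct 1 of JetchevPrintFactsX9
— filed so the cite_only head constant is item-stated BY NAME (gate5 #15c one rule; staffable
remedy); banked context (D-0019 aside): never staffed, not progress, closes only when the named fact
becomes a theorem. -/
@[route_item "route-BirchSwinnertonDyer-KolyvaginDepthDoor", crux]
def GrossFrobeniusCongruence : Prop :=
  Literature.NumberTheory.EllipticCurves.GrossLMS1991.prop37_2_frobeniusCongruence

/-- item stmt-BirchSwinnertonDyer-22821 · support · rank 9 · open · by planner
sources: Kolyvagin1991MathAnn, GrossLMS1991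
[support] THE KN DOOR (glue, provable NOW): KolyvaginDepthSupplyKN → (γ) → X1 on non-CM curves (∃ p
≥ 5 good ordinary with corank_ℤ_p Ш(E)[p^∞] = 0). Prover recipe (lean-checked in the planner's
scratch): one file importing Theorems.KolyvaginDepthDoorKolyvaginDepthSupplySignedDatumKNDoor + this
route; `intro hS hγ W _ _ hcm; obtain ⟨p, hp, h5, hgood, hord, hsha, -⟩ :=
shaCorank_eq_zero_nonCM_of_kolyvaginDepthSupplySignedDatumKN_print hS hγ W hcm; exact ⟨p, hp, h5,
hgood, hord, hsha⟩` (the crux body is the tree def verbatim, Iff.rfl). [deps: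
KolyvaginDepthSupplyKN, GrossFrobeniusCongruence] [difficulty: provable-now] -/
@[route_item "route-BirchSwinnertonDyer-KolyvaginDepthDoor", crux]
def KolyvaginDoorKN : Prop :=
  KolyvaginDepthSupplyKN → GrossFrobeniusCongruence → ∀ (W : WeierstrassCurve ℚ) [W.IsElliptic] [W.IsGloballyMinimal], ¬ W.HasCM → ∃ (p : ℕ) (_ : Fact p.Prime), 5 ≤ p ∧ W.HasGoodReductionAtPrime p ∧ ¬ (p : ℤ) ∣ W.frobeniusTrace p ∧ W.shaCorank p = 0

/-- item stmt-BirchSwinnertonDyer-21768 · assembly · rank 1 · closed · proved by Summit.BirchSwinnertonDyer.BirchSwinnertonDyer.Theorems.kolyvaginDepthDoor_assembly_proof (prover) · by planner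
sources: Kolyvagin1991MathAnn, Kato2004Asterisque
[assembly] KolyvaginDepthSupply → KolyvaginStructure → ShaCorankZeroAtOnePrimeOfCM →
AnalyticRankLeSelmerCorank → PadicOrderLeAnalyticRankAtOnePrime → KatoRankBound → BSD-rank. -/
@[route_item "route-BirchSwinnertonDyer-KolyvaginDepthDoor"]
def Assembly : Prop :=
  KolyvaginDepthSupply → KolyvaginStructure → ShaCorankZeroAtOnePrimeOfCM → AnalyticRankLeSelmerCorank → PadicOrderLeAnalyticRankAtOnePrime → KatoRankBound → _root_.BirchSwinnertonDyer

-- `Assembly` holds: proved by `Summit.BirchSwinnertonDyer.BirchSwinnertonDyer.Theorems.kolyvaginDepthDoor_assembly_proof` (its module imports this route file, so no `_holds` link can be stated here).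

/-! D-0027 §2.1 — DECIDING THEOREM (planner-authored via `route open/edit --closes-file`; by planner-bsd-idea-4-g16-0 2026-08-28T16:59:38Z):
its hypotheses are this route's items and its conclusion the sub-problem Statement (glue_lint), and it elaborates with this file. -/

@[closes "route-BirchSwinnertonDyer-KolyvaginDepthDoor"] theorem closes (hS : KolyvaginDepthSupplyKN) (hγ : GrossFrobeniusCongruence) (hD : KolyvaginDoorKN)
    (hCM : ShaCorankZeroAtOnePrimeOfCM) (hX2 : AnalyticRankLeSelmerCorank)
    (hX3 : PadicOrderLeAnalyticRankAtOnePrime) (hK : KatoRankBound) : _root_.BirchSwinnertonDyer := by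
  -- X1 at one prime for EVERY elliptic curve: non-CM from the KN depth door (hS, (γ), hD), CM from hCM
  have hX1 : ∀ (W : WeierstrassCurve ℚ) [W.IsElliptic] [W.IsGloballyMinimal],
      ∃ (p : ℕ) (_ : Fact p.Prime), 5 ≤ p ∧ W.HasGoodReductionAtPrime p ∧
        ¬ (p : ℤ) ∣ W.frobeniusTrace p ∧ W.shaCorank p = 0 := by
    intro W _ _
    by_cases hcm : W.HasCM
    · exact hCM W hcm
    · exact hD hS hγ W hcm
  -- (T1) the Mordell–Weil rank is an isomorphism invariant (AEC III.3.1(b); `VariableChangePoints`)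
  have hMW : ∀ (W : WeierstrassCurve ℚ) (C : WeierstrassCurve.VariableChange ℚ),
      (C • W).mordellWeilRank = W.mordellWeilRank := fun W C =>
    @WeierstrassCurve.VariableChange.finrank_point_variableChange ℚ _ W C (Classical.decEq ℚ)
  -- (T2) the local Euler factor over the fraction field of a DVR is an isomorphism invariant
  have hloc : ∀ (R : Type) [CommRing R] [IsDomain R] [IsDiscreteValuationRing R]
      (K : Type) [Field K] [Algebra R K] [IsFractionRing R K]
      (W : WeierstrassCurve K) [W.IsElliptic] (C : WeierstrassCurve.VariableChange K),
      (C • W).localEulerFactor R = W.localEulerFactor R := by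
    intro R _ _ _ K _ _ _ W _ C
    obtain ⟨D, hD⟩ : ∃ D : WeierstrassCurve.VariableChange K,
        (C • W).minimal R = D • W.minimal R :=
      ⟨((C • W).exists_isMinimal R).choose * C * ((W.exists_isMinimal R).choose)⁻¹, by
        rw [WeierstrassCurve.minimal, WeierstrassCurve.minimal, mul_smul, mul_smul, inv_smul_smul]⟩
    haveI hE : (W.minimal R).IsElliptic := by rw [WeierstrassCurve.minimal]; infer_instance
    have hΔ : (W.minimal R).Δ ≠ 0 := (W.minimal R).isUnit_Δ.ne_zero
    have hgood : ((C • W).minimal R).HasGoodReduction R ↔ (W.minimal R).HasGoodReduction R := by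
      rw [WeierstrassCurve.hasGoodReduction_iff, WeierstrassCurve.hasGoodReduction_iff,
        WeierstrassCurve.valuation_Δ_eq_of_isMinimal_of_eq_smul R hD]
      exact and_congr_left' ⟨fun _ => inferInstance, fun _ => inferInstance⟩
    have hcard : Nat.card (((C • W).minimal R).reduction R).toAffine.Point =
        Nat.card ((W.minimal R).reduction R).toAffine.Point := by
      obtain ⟨E, hE⟩ := WeierstrassCurve.exists_reduction_eq_smul R hD hΔ
      rw [hE]
      exact WeierstrassCurve.natCard_point_smul _ _
    have hpoly : (C • W).localPolynomial R = W.localPolynomial R := by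
      classical
      unfold WeierstrassCurve.localPolynomial
      simp only [hgood, hcard,
        WeierstrassCurve.hasSplitMultiplicativeReduction_iff_of_isMinimal_of_eq_smul R hD hΔ,
        WeierstrassCurve.hasMultiplicativeReduction_iff_of_isMinimal_of_eq_smul R hD hΔ]
    simp only [WeierstrassCurve.localEulerFactor, WeierstrassCurve.localPowerSeries, hpoly]
  -- (T3) hence the analytic rank `ord_{s=1} L(E,s)` is an isomorphism invariant (AEC App. C §16)
  have hAn : ∀ (W : WeierstrassCurve ℚ) [W.IsElliptic] (C : WeierstrassCurve.VariableChange ℚ),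
      (C • W).analyticRank = W.analyticRank := by
    intro W _ C
    have hL : (C • W).LFunction = W.LFunction := by
      unfold WeierstrassCurve.LFunction
      congr 1
      funext v
      simp only [WeierstrassCurve.baseChange, ← WeierstrassCurve.map_variableChange]
      exact hloc _ _ _ _
    have hLS : (C • W).LSeries = W.LSeries := by
      funext s
      simp only [WeierstrassCurve.LSeries, hL]
    have hEC : (C • W).entireContinuations = W.entireContinuations := by
      simp only [WeierstrassCurve.entireContinuations, hLS]
    have hEL : (C • W).entireLFunction = W.entireLFunction := by
      unfold WeierstrassCurve.entireLFunction
      rw [hEC, hLS]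
    simp only [WeierstrassCurve.analyticRank, hEL]
  -- the two legs on a global minimal model `C • W` of an arbitrary elliptic `W`
  intro W hW
  obtain ⟨C, hC⟩ := WeierstrassCurve.hasGlobalMinimalModel_rat_holds W
  -- leg 1 (lower bound r_an ≤ r_MW): X1 at p₁, the Kummer identity, X2 at p₁
  have hLB : (C • W).analyticRank ≤ (C • W).mordellWeilRank := by
    obtain ⟨p, hp, h5, hgood, hord, hsha⟩ := hX1 (C • W)
    have hid : (C • W).selmerCorank p = (C • W).mordellWeilRank + (C • W).shaCorank p :=
      WeierstrassCurve.selmerCorank_eq_mordellWeilRank_add_holds (C • W) p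
    have h2 := hX2 (C • W) p h5 hgood hord
    omega
  -- leg 2 (upper bound r_MW ≤ r_an): X3 at (p₂, f), the Kato side at (p₂, f)
  have hUB : (C • W).mordellWeilRank ≤ (C • W).analyticRank := by
    obtain ⟨p, hp, h5, hgood, hord, N, hN, f, hf, hle⟩ := hX3 (C • W)
    have hp2 : p ≠ 2 := by omega
    have hordAt : Literature.NumberTheory.EllipticCurves.IsOrdinaryAt (C • W) p := ⟨hgood, hord⟩
    have hk := hK (C • W) p hp2 hordAt f hf
    exact_mod_cast hk.trans hle
  have h := le_antisymm hLB hUB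
  rw [hAn W C, hMW W C] at h
  exact h

end Summit.BirchSwinnertonDyer.BirchSwinnertonDyer.Theses.KolyvaginDepthDoor
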